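/-
Copyright (c) 2026 the pub-hodgecm-mathlib formalisation cell (harness21).  Prover seat hodgecm-mathlib-A-p19 (g26): T3′ P-2 row (R2²) organ [T2-c], abstract layer 2∕2
«DESCENT OF THE ADDITIVE INDEX AND THE NORM FIBRATION OF THE UNIT INDEX» (road «S3-tree», crux H413).
-/
import Mathlib.GroupTheory.Index
import Mathlib.Algebra.Ring.Subring.Basic
import Mathlib.RingTheory.Ideal.Maps
import Mathlib.Algebra.Group.Submonoid.Units
import HarnessLib

/-!
# An involution `⋆` on a commutative ring: `[Λ : R] = [Λ^⋆ : R^⋆]²` along `x = x₀ + x₁ξ`, and `[C : V] · [Λ^{⋆×} : V ∩ Λ^{⋆×}] = [Λ^× : V]` for `C = N⁻¹(V)`, `N = id · ⋆`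

Topic `RingTheory/GaloisAlgebras`; namespace `Literature.RingTheory.GaloisAlgebras`.  THEOREMS ONLY (no definition, no instance, no notation, no named fact, no `sorry`); Mathlib-only.
The any-ring, coordinate-free twins of ★ O3∕O4 `QuadraticInvolutionDescentIndex` (typed on `Fin n → K`): here `Λ` is ANY commutative ring with a ring involution `⋆ = s`, so the NON-SPLIT
eigen-algebra `L_w × K₁` of a type-(2) torus (T3′ P-2 row (R2²), cell `pub/hodgecm-mathlib`, crux H413 = `stmt-HodgeConjecture-24833`, architect A-p16 (g30) A-106∕A-110) is served.
HONEST LABEL: HC_CM is proved only modulo the 2 remaining named inputs (hLiu418 24832, h413 24833) until rung 0 closes; elementary algebra, asserts nothing printed.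

THE MATHEMATICS.  (§1) Let `ξ ∈ Λ` with `ξ − ξ⋆` invertible, inverse `e′`.  Every `x` is uniquely `x₀ + x₁ξ` with `x₀, x₁ ∈ Λ^⋆` (`x₁ = e′(x − x⋆)`, `x₀ = x − x₁ξ`; note `e′⋆ = −e′`), so
`Λ^⋆ × Λ^⋆ ≃ Λ` additively; a `⋆`-stable subring `R ∋ ξ, e′` corresponds to `R^⋆ × R^⋆`, whence **`[Λ : R] = [Λ^⋆ : R^⋆]²`** (Mathlib `AddSubgroup.index_prod`).  (§2) On `Λ^×` the norm
`N(x) = x·x⋆` is a homomorphism into the fixed units; if every fixed unit is a norm then `range N = (Λ^⋆)^×`, and for a subgroup `V ≤ Λ^×` with `N(V) ⊆ V` and `C := N⁻¹(V)`: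
**`[C : V] · [(Λ^⋆)^× : V ∩ (Λ^⋆)^×] = [Λ^× : V]`** (Mathlib `Subgroup.relIndex_mul_index`, `Subgroup.index_comap`) — the shape `[C : R^×]·[𝒪_{A^⋆}^× : R^{⋆×}] = [𝒪_A^× : R^×]` of the
unit-index seam (Serre, *Local Fields*, Ch. V §2: units are norms at an unramified quadratic extension).

* §1 `map_inv_sub_eq_neg`, `fixed_decomposition`, `exists_addEquiv_eqLocus_prod`, **`index_eq_relIndex_eqLocus_sq`**.
* §2 `norm_mem_units_eqLocus`, `range_norm_eq_units_eqLocus`, **`relIndex_comap_norm_mul_relIndex_eq_index`**.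

## References
* [SerreLocalFields1979] J.-P. Serre, *Local Fields*, GTM 67 (1979): Ch. V §2 Prop. 3 and Corollary (units are norms at an unramified extension).
* [Hungerford1974] T. W. Hungerford, *Algebra*, GTM 73 (1974): Ch. I Thm. 4.5 (index multiplicativity), Thm. 5.11 (correspondence theorem).
* [Neukirch1999] J. Neukirch, *Algebraic Number Theory*, Grundlehren 322 (1999): Ch. I §12 (orders and their unit indices).
-/

set_option autoImplicit false

namespace Literature.RingTheory.GaloisAlgebras

/-! ## §1 Descent of the additive index along `x = x₀ + x₁ ξ` -/

section Descent

variable {Λ : Type*} [CommRing Λ] (s : Λ →+* Λ) (hss : ∀ x, s (s x) = x) {ξ e' : Λ} (he : e' * (ξ - s ξ) = 1)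

include hss he in
/-- `e′⋆ = −e′` for the inverse `e′` of `ξ − ξ⋆` (`(ξ − ξ⋆)⋆ = −(ξ − ξ⋆)`). [cite: Hungerford1974, Ch. I Thm. 4.5] -/
theorem map_inv_sub_eq_neg : s e' = -e' := by
  have h1 : s e' * (s ξ - ξ) = 1 := by
    have := congrArg s he
    rwa [map_mul, map_sub, hss, map_one] at this
  have h2 : (-e') * (s ξ - ξ) = 1 := by rw [← he]; ring
  -- uniqueness of the inverse of the unit `s ξ - ξ`
  have hu : IsUnit (s ξ - ξ) := IsUnit.of_mul_eq_one_right _ h2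
  obtain ⟨w, hw⟩ := hu
  have k1 : s e' = ↑w⁻¹ := by
    rw [← hw] at h1
    calc s e' = s e' * (↑w * ↑w⁻¹) := by rw [Units.mul_inv, mul_one]
      _ = (s e' * ↑w) * ↑w⁻¹ := by rw [mul_assoc]
      _ = ↑w⁻¹ := by rw [h1, one_mul]
  have k2 : -e' = ↑w⁻¹ := by
    rw [← hw] at h2
    calc -e' = -e' * (↑w * ↑w⁻¹) := by rw [Units.mul_inv, mul_one]
      _ = (-e' * ↑w) * ↑w⁻¹ := by rw [mul_assoc]
      _ = ↑w⁻¹ := by rw [h2, one_mul]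
  rw [k1, k2]

include hss he in
/-- **THE DECOMPOSITION `x = x₀ + x₁ξ`**: `x₁ := e′(x − x⋆)` and `x₀ := x − x₁ξ` are `⋆`-fixed. [cite: Hungerford1974, Ch. I Thm. 4.5] -/
theorem fixed_decomposition (x : Λ) :
    s (e' * (x - s x)) = e' * (x - s x) ∧ s (x - e' * (x - s x) * ξ) = x - e' * (x - s x) * ξ := by
  have hse := map_inv_sub_eq_neg s hss he
  have h1 : s (e' * (x - s x)) = e' * (x - s x) := by
    rw [map_mul, hse, map_sub, hss]; ring
  refine ⟨h1, ?_⟩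
  rw [map_sub, map_mul, h1]
  -- `x − x⋆ = x₁ (ξ − ξ⋆)`
  have key : e' * (x - s x) * (ξ - s ξ) = x - s x := by
    rw [mul_assoc, mul_comm (x - s x), ← mul_assoc, he, one_mul]
  calc s x - e' * (x - s x) * s ξ = x - (x - s x) - e' * (x - s x) * s ξ := by ring
    _ = x - e' * (x - s x) * (ξ - s ξ) - e' * (x - s x) * s ξ := by rw [key]
    _ = x - e' * (x - s x) * ξ := by ring

include hss he in
/-- **`Λ^⋆ × Λ^⋆ ≃ Λ` ADDITIVELY**, `(x₀, x₁) ↦ x₀ + x₁ξ`; a `⋆`-stable subring `R ∋ ξ, e′` pulls back to `R^⋆ × R^⋆` (`R^⋆ = R ∩ Λ^⋆` read inside `Λ^⋆`).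
[cite: Hungerford1974, Ch. I Thm. 4.5] -/
theorem exists_addEquiv_eqLocus_prod (R : Subring Λ) (hsR : ∀ x ∈ R, s x ∈ R) (hξ : ξ ∈ R) (he' : e' ∈ R) :
    ∃ Θ : (RingHom.eqLocus s (RingHom.id Λ)).toAddSubgroup × (RingHom.eqLocus s (RingHom.id Λ)).toAddSubgroup ≃+ Λ,
      (∀ p, Θ p = (p.1 : Λ) + (p.2 : Λ) * ξ) ∧
      R.toAddSubgroup.comap Θ.toAddMonoidHom =
        (R.toAddSubgroup.addSubgroupOf (RingHom.eqLocus s (RingHom.id Λ)).toAddSubgroup).prod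
          (R.toAddSubgroup.addSubgroupOf (RingHom.eqLocus s (RingHom.id Λ)).toAddSubgroup) := by
  set B : AddSubgroup Λ := (RingHom.eqLocus s (RingHom.id Λ)).toAddSubgroup with hB
  have hmemB : ∀ x : Λ, x ∈ B ↔ s x = x := fun x => by rw [hB]; exact Iff.rfl
  set Θ₀ : B × B →+ Λ :=
    { toFun := fun p => (p.1 : Λ) + (p.2 : Λ) * ξ
      map_zero' := by simp
      map_add' := fun p q => by
        simp only [Prod.fst_add, Prod.snd_add, AddSubgroup.coe_add]; ring } with hΘ₀
  have hΘ₀apply : ∀ p, Θ₀ p = (p.1 : Λ) + (p.2 : Λ) * ξ := fun _ => rfl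
  -- the coordinate identities
  have hcoord : ∀ (x₀ x₁ : Λ), s x₀ = x₀ → s x₁ = x₁ → e' * ((x₀ + x₁ * ξ) - s (x₀ + x₁ * ξ)) = x₁ := by
    intro x₀ x₁ h0 h1
    rw [map_add, map_mul, h0, h1]
    calc e' * (x₀ + x₁ * ξ - (x₀ + x₁ * s ξ)) = x₁ * (e' * (ξ - s ξ)) := by ring
      _ = x₁ := by rw [he, mul_one]
  have hbij : Function.Bijective Θ₀ := by
    constructor
    · rintro ⟨⟨x₀, hx₀⟩, ⟨x₁, hx₁⟩⟩ ⟨⟨y₀, hy₀⟩, ⟨y₁, hy₁⟩⟩ h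
      simp only [hΘ₀apply] at h
      rw [hmemB] at hx₀ hx₁ hy₀ hy₁
      have h1 : x₁ = y₁ := by rw [← hcoord x₀ x₁ hx₀ hx₁, ← hcoord y₀ y₁ hy₀ hy₁, h]
      have h0 : x₀ = y₀ := by
        have := h; rw [h1] at this; exact add_right_cancel this
      simp only [h0, h1]
    · intro x
      obtain ⟨h1, h0⟩ := fixed_decomposition s hss he x
      refine ⟨(⟨x - e' * (x - s x) * ξ, (hmemB _).2 h0⟩, ⟨e' * (x - s x), (hmemB _).2 h1⟩), ?_⟩
      rw [hΘ₀apply]; ring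
  refine ⟨AddEquiv.ofBijective Θ₀ hbij, fun p => rfl, ?_⟩
  ext ⟨⟨x₀, hx₀⟩, ⟨x₁, hx₁⟩⟩
  simp only [AddSubgroup.mem_comap, AddSubgroup.mem_prod, AddSubgroup.mem_addSubgroupOf, Subring.mem_toAddSubgroup]
  change x₀ + x₁ * ξ ∈ R ↔ x₀ ∈ R ∧ x₁ ∈ R
  rw [hmemB] at hx₀ hx₁
  constructor
  · intro h
    have h1 : x₁ ∈ R := by
      rw [← hcoord x₀ x₁ hx₀ hx₁]
      exact R.mul_mem he' (R.sub_mem h (hsR _ h))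
    exact ⟨by simpa using R.sub_mem h (R.mul_mem h1 hξ), h1⟩
  · rintro ⟨h0, h1⟩
    exact R.add_mem h0 (R.mul_mem h1 hξ)

include hss he in
/-- **DESCENT OF THE ADDITIVE INDEX: `[Λ : R] = [Λ^⋆ : R^⋆]²`** for a `⋆`-stable subring `R` containing `ξ` and `(ξ − ξ⋆)⁻¹` (`R^⋆ = R ∩ Λ^⋆`; Mathlib `AddSubgroup.index_prod`).
The coordinate-free twin of ★ O3 `relIndex_inf_fixed_sq_eq_relIndex`. [cite: Hungerford1974, Ch. I Thm. 4.5] [cite: Neukirch1999, Ch. I §12] -/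
theorem index_eq_relIndex_eqLocus_sq (R : Subring Λ) (hsR : ∀ x ∈ R, s x ∈ R) (hξ : ξ ∈ R) (he' : e' ∈ R) :
    R.toAddSubgroup.index = (R.toAddSubgroup.relIndex (RingHom.eqLocus s (RingHom.id Λ)).toAddSubgroup) ^ 2 := by
  obtain ⟨Θ, -, hΘ⟩ := exists_addEquiv_eqLocus_prod s hss he R hsR hξ he'
  rw [← AddSubgroup.index_comap_of_surjective R.toAddSubgroup (f := Θ.toAddMonoidHom) Θ.surjective, hΘ, AddSubgroup.index_prod, sq]
  rfl

end Descent

/-! ## §2 The norm `N = id · ⋆` on `Λ^×`: range and the index fibration -/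

section Norm

variable {Λ : Type*} [CommRing Λ] (s : Λ →+* Λ) (hss : ∀ x, s (s x) = x)

/-- `N(t) = t·t⋆` is a `⋆`-fixed unit with `⋆`-fixed inverse, i.e. lies in the unit group of the fixed subring `Λ^⋆`. [cite: SerreLocalFields1979, Ch. V §2] -/
theorem norm_mem_units_eqLocus (hss : ∀ x, s (s x) = x) (t : Λˣ) :
    (MonoidHom.id Λˣ * Units.map (s : Λ →* Λ)) t ∈ (RingHom.eqLocus s (RingHom.id Λ)).toSubmonoid.units := by
  rw [Submonoid.mem_units_iff]
  have hval : (((MonoidHom.id Λˣ * Units.map (s : Λ →* Λ)) t : Λˣ) : Λ) = (t : Λ) * s t := by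
    rw [MonoidHom.mul_apply, Units.val_mul, MonoidHom.id_apply, Units.coe_map]; rfl
  have hfix : s ((t : Λ) * s t) = (t : Λ) * s t := by rw [map_mul, hss, mul_comm]
  have hmem : ∀ u : Λˣ, s (u : Λ) = u → s (↑u⁻¹ : Λ) = ↑u⁻¹ := by
    intro u hu
    have h : s (↑u⁻¹ : Λ) * (u : Λ) = 1 := by
      conv_lhs => rw [← hu, ← map_mul, Units.inv_mul, map_one]
    calc s (↑u⁻¹ : Λ) = s (↑u⁻¹ : Λ) * ((u : Λ) * ↑u⁻¹) := by rw [Units.mul_inv, mul_one]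
      _ = ↑u⁻¹ := by rw [← mul_assoc, h, one_mul]
  constructor
  · change s _ = _
    rw [hval, hfix]; rfl
  · change s _ = _
    have := hmem ((MonoidHom.id Λˣ * Units.map (s : Λ →* Λ)) t) (by rw [hval, hfix])
    rw [this]; rfl

include hss in
/-- **`range N = (Λ^⋆)^×` WHEN EVERY FIXED UNIT IS A NORM** (`u = t·t⋆`) — e.g. for the unit group of `𝒪_w × 𝒪[K₁]` at an inert ∕ unramified-over-`K` place.
[cite: SerreLocalFields1979, Ch. V §2 Prop. 3 and Corollary] -/
theorem range_norm_eq_units_eqLocus (hsurj : ∀ u : Λˣ, s u = u → ∃ t : Λˣ, (t : Λ) * s t = u) :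
    (MonoidHom.id Λˣ * Units.map (s : Λ →* Λ)).range = (RingHom.eqLocus s (RingHom.id Λ)).toSubmonoid.units := by
  ext u
  constructor
  · rintro ⟨t, rfl⟩
    exact norm_mem_units_eqLocus s hss t
  · intro hu
    rw [Submonoid.mem_units_iff] at hu
    have hfix : s (u : Λ) = u := hu.1
    obtain ⟨t, ht⟩ := hsurj u hfix
    refine ⟨t, Units.ext ?_⟩
    rw [MonoidHom.mul_apply, Units.val_mul, MonoidHom.id_apply, Units.coe_map]
    exact ht

/-- **THE INDEX FIBRATION OF THE NORM**: for `V ≤ Λ^×` with `N(V) ⊆ V`, `C := N⁻¹(V)` and `W := range N`:  **`[C : V] · [W : V ∩ W] = [Λ^× : V]`**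
(`[C : V] = V.relIndex C`, `[W : V ∩ W] = V.relIndex W`; Mathlib `Subgroup.relIndex_mul_index` + `Subgroup.index_comap`).  With §2's `W = (Λ^⋆)^×` this is the unit-index seam
`[C : R^×]·[𝒪_{A^⋆}^× : R^{⋆×}] = [𝒪_A^× : R^×]`. [cite: Hungerford1974, Ch. I Thm. 4.5, Thm. 5.11] [cite: Neukirch1999, Ch. I §12] -/
theorem relIndex_comap_norm_mul_relIndex_eq_index (V : Subgroup Λˣ)
    (hV : V ≤ V.comap (MonoidHom.id Λˣ * Units.map (s : Λ →* Λ))) :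
    V.relIndex (V.comap (MonoidHom.id Λˣ * Units.map (s : Λ →* Λ))) * V.relIndex (MonoidHom.id Λˣ * Units.map (s : Λ →* Λ)).range = V.index := by
  rw [← Subgroup.index_comap]
  exact Subgroup.relIndex_mul_index hV

end Norm

end Literature.RingTheory.GaloisAlgebras
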